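import Literature.MathematicalPhysics.QuantumFieldTheory.Federbush1986.ModeLinearity
import Literature.MathematicalPhysics.QuantumFieldTheory.Federbush1986.AxialTreePureGauge
import Mathlib.Analysis.Calculus.BumpFunction.Convolution
import Mathlib.Analysis.Calculus.ContDiff.Convolution
import Mathlib.Analysis.Calculus.ParametricIntegral
import Mathlib.Analysis.Calculus.FDeriv.Symmetric

/-!
# `Federbush1986.FieldMollification` — [Federbush1986PhaseCellI] §0 p. 319–320 / (3.2) p. 327: MOLLIFICATION OF VECTOR
# POTENTIALS — `ρ ⋆ ψ` is smooth, `F(ρ ⋆ ψ) = ρ ⋆ F(ψ)` for `ψ ∈ C¹`, `F(ρ ⋆ dΛ) = 0` for `Λ ∈ C¹`, and `ρ ⋆ ψ → ψ`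
# uniformly on compacts — PROVED (Mathlib convolution with normed bump functions)

statement-level skeleton of published theorems with citation tags; proofs where landed; nothing here is a claim about the Yang–Mills mass gap

CITATION HEADER.  P. Federbush, *A phase cell approach to Yang–Mills theory. I*, Commun. Math. Phys. **107** (1986) 319–329
[Federbush1986PhaseCellI]: §0 p. 319–320 (the gauge-invariant continuum action `∫Σ_{μ<ν}F²`, `F_{μν} = ∂_μA_ν − ∂_νA_μ`),
§2 p. 325 verbatim *«[We always assume A_μ(x) is continuously differentiable.]»*, (3.2) p. 327 `A = A^N + ∂Λ`.  Infrastructure for the constrained minimality of the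
mode against a general `C¹` competitor (hypothesis `hmin` of `CorrectedMode.modeEstimatesLe_of_field_minimal`): the Euler–Lagrange
identity of `LandauModeBondMultipliers` is stated for smooth compactly supported test fields, and a gauge-fixed `C¹`
competitor is only continuous, so it is mollified.  HYPOTHESES VS PRINT: print works throughout with `C¹` potentials (the bracketed
sentence of §2 p. 325 above); the theorems of this module assume only CONTINUITY of the function being mollified (`Continuous g` in
`contDiff_moll`, `moll_uniform`, `mollV_uniform`) and `C¹` where a derivative is moved (`hasFDerivAt_moll`, `fieldStrength_mollV`) — a
weaker hypothesis than print's, not a quotation of it.  Unit `lit-balaban-r17` gen 12; SKELETON rows F1.Eq3.1, F1.Eq3.2-3.12.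
v1.1 (r17 gen 13, DOCFIX DF-g46-2 of referee ref-5 gen 46; declarations untouched): the v1 header and the docstring of `moll` attributed
a paraphrase «A_μ(x) (assumed continuous)» to §2 p. 325; replaced by the printed sentence verbatim and the hypothesis comparison above.

THE MATHEMATICS.  `moll φ g = φ.normed ⋆ g` (Mathlib `ContDiffBump.normed`, `MeasureTheory.convolution` with `lsmul`):
smooth for continuous `g` (`contDiff_moll`, Mathlib `HasCompactSupport.contDiff_convolution_left`), `η`-close to `g` uniformly on a
compact set once the bump radius is small (**`moll_uniform`**, uniform continuity + `ContDiffBump.dist_normed_convolution_le`),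
and for `g ∈ C¹` differentiation passes onto `g`: `D(ρ ⋆ g) = ρ ⋆ Dg` (**`hasFDerivAt_moll`**, **`fderiv_moll_apply`**,
differentiation under the integral).  Componentwise for vector potentials (`mollV`): `∂_μ(ρ⋆ψ)_ν = ρ⋆∂_μψ_ν` (`pd_mollV`),
**`fieldStrength_mollV`** `F_{μν}(ρ ⋆ ψ) = ρ ⋆ F_{μν}(ψ)`, `ρ ⋆ dΛ = d(ρ ⋆ Λ)` (`mollV_pureGauge`), `F(dΘ) = 0` for `Θ ∈ C²`
(symmetry of second derivatives, `fieldStrength_pureGauge`), hence **`fieldStrength_mollV_pureGauge`** `F(ρ ⋆ dΛ) = 0` for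
`Λ ∈ C¹`; **`mollV_uniform`**.

WHAT THIS MODULE PROVIDES.  Defs with bodies `moll`, `mollV`; the theorems above.  No `Prop` fact, no `sorry`; axioms standard.
-/

namespace Literature.MathematicalPhysics.QuantumFieldTheory.Federbush1986

open Filter Set MeasureTheory Metric
open scoped Topology BigOperators Convolution Pointwise

noncomputable section

namespace Mollify

open ModeLinearity

variable (φ : ContDiffBump (0 : E4))

/-! ## §1 Mollification of a continuous scalar function by a normed bump -/

/-- The mollification `ρ ⋆ g` of a scalar function by the normed bump `ρ = φ/∫φ`.
[cite: Federbush1986PhaseCellI, §2 p. 325 («[We always assume A_μ(x) is continuously differentiable.]»; here only continuity of `g` is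
used), §0 p. 319–320] -/
def moll (g : E4 → ℝ) : E4 → ℝ := φ.normed volume ⋆[ContinuousLinearMap.lsmul ℝ ℝ, volume] g

variable {φ}

/-- `(ρ ⋆ g)(x) = ∫ ρ(y) g(x − y) dy`. [cite: Federbush1986PhaseCellI, §0 p. 319–320] -/
theorem moll_apply (g : E4 → ℝ) (x : E4) : moll φ g x = ∫ y, φ.normed volume y * g (x - y) := by
  rw [moll, convolution_lsmul]; rfl

/-- `ρ ⋆ g` is smooth for continuous `g`. [cite: Federbush1986PhaseCellI, §0 p. 319–320] -/
theorem contDiff_moll {g : E4 → ℝ} (hg : Continuous g) {n : ℕ∞} : ContDiff ℝ n (moll φ g) :=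
  φ.hasCompactSupport_normed.contDiff_convolution_left _ φ.contDiff_normed (hg.locallyIntegrable (μ := volume))

/-- `ρ ⋆ g` is continuous. [cite: Federbush1986PhaseCellI, §0 p. 319–320] -/
theorem continuous_moll {g : E4 → ℝ} (hg : Continuous g) : Continuous (moll φ g) :=
  (contDiff_moll (n := 0) hg).continuous

/-- Approximation at a point: if `g` varies by `≤ ε` on `B(x, r_out)` then `|(ρ ⋆ g)(x) − g(x)| ≤ ε`.
[cite: Federbush1986PhaseCellI, §0 p. 319–320] -/
theorem dist_moll_le {g : E4 → ℝ} (hg : Continuous g) {x : E4} {ε : ℝ}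
    (h : ∀ y ∈ ball x φ.rOut, dist (g y) (g x) ≤ ε) : dist (moll φ g x) (g x) ≤ ε :=
  φ.dist_normed_convolution_le hg.aestronglyMeasurable h

/-- **Uniform approximation on compact sets**: for continuous `g` and compact `K`, mollifiers of small radius approximate
`g` uniformly on `K`. [cite: Federbush1986PhaseCellI, §0 p. 319–320] -/
theorem moll_uniform {g : E4 → ℝ} (hg : Continuous g) {K : Set E4} (hK : IsCompact K) {ε : ℝ} (hε : 0 < ε) :
    ∃ δ > 0, ∀ φ : ContDiffBump (0 : E4), φ.rOut ≤ δ → ∀ x ∈ K, |moll φ g x - g x| ≤ ε := by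
  have hK' : IsCompact (K + closedBall (0 : E4) 1) := hK.add (isCompact_closedBall _ _)
  obtain ⟨δ, hδ, hU⟩ := Metric.uniformContinuousOn_iff.1 (hK'.uniformContinuousOn_of_continuous hg.continuousOn) ε hε
  refine ⟨min δ 1, lt_min hδ one_pos, fun φ hφ x hx => ?_⟩
  rw [← Real.dist_eq]
  refine dist_moll_le hg fun y hy => (hU y ?_ x ?_ ?_).le
  · have : y = x + (y - x) := by abel
    rw [this]
    exact Set.add_mem_add hx (mem_closedBall_zero_iff.2 ((mem_ball_iff_norm.1 hy).le.trans (hφ.trans (min_le_right _ _))))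
  · have : x = x + 0 := by simp
    rw [this]; exact Set.add_mem_add hx (mem_closedBall_self zero_le_one)
  · rw [dist_comm]; exact (mem_ball'.1 hy).trans_le (hφ.trans (min_le_left _ _))

/-- `ρ ⋆ (f − g) = ρ ⋆ f − ρ ⋆ g` for continuous `f, g`. [cite: Federbush1986PhaseCellI, §0 p. 319–320] -/
theorem moll_sub {f g : E4 → ℝ} (hf : Continuous f) (hg : Continuous g) (x : E4) :
    moll φ (fun y => f y - g y) x = moll φ f x - moll φ g x := by
  simp only [moll_apply, mul_sub]
  have hi : ∀ {h : E4 → ℝ}, Continuous h → Integrable fun y => φ.normed volume y * h (x - y) := fun hh =>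
    ((φ.contDiff_normed (n := 0)).continuous.mul (hh.comp (continuous_const.sub continuous_id))).integrable_of_hasCompactSupport
      (φ.hasCompactSupport_normed.mul_right)
  exact integral_sub (hi hf) (hi hg)

/-- `ρ ⋆ (c g) = c (ρ ⋆ g)`. [cite: Federbush1986PhaseCellI, §0 p. 319–320] -/
theorem moll_const_mul (g : E4 → ℝ) (c : ℝ) (x : E4) : moll φ (fun y => c * g y) x = c * moll φ g x := by
  simp only [moll_apply]
  rw [← integral_const_mul]
  refine integral_congr_ae (Eventually.of_forall fun y => ?_)
  simp only; ring

/-! ## §2 Mollification commutes with differentiation of `C¹` functions -/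

/-- A bound for `‖Dg‖` on a ball. [folklore] -/
private theorem exists_bound_fderiv {g : E4 → ℝ} (hg : ContDiff ℝ 1 g) (x₀ : E4) (R : ℝ) :
    ∃ M, 0 ≤ M ∧ ∀ z ∈ closedBall x₀ R, ‖fderiv ℝ g z‖ ≤ M := by
  obtain ⟨C, hC⟩ := (isCompact_closedBall x₀ R).exists_bound_of_continuousOn
    ((hg.continuous_fderiv one_ne_zero).continuousOn)
  exact ⟨max C 0, le_max_right _ _, fun z hz => (hC z hz).trans (le_max_left _ _)⟩

/-- **`D(ρ ⋆ g) = ρ ⋆ Dg` for `g ∈ C¹`** (differentiation under the integral sign, the derivative falling on `g`).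
[cite: Federbush1986PhaseCellI, §0 p. 319–320, Estimate 0.2 (0.3) p. 320] -/
theorem hasFDerivAt_moll {g : E4 → ℝ} (hg : ContDiff ℝ 1 g) (x₀ : E4) :
    Integrable (fun y => φ.normed volume y • fderiv ℝ g (x₀ - y)) ∧
    HasFDerivAt (moll φ g) (∫ y, φ.normed volume y • fderiv ℝ g (x₀ - y)) x₀ := by
  obtain ⟨M, hM0, hM⟩ := exists_bound_fderiv hg x₀ (1 + φ.rOut)
  have hρc : Continuous (φ.normed volume) := (φ.contDiff_normed (n := 0)).continuous
  have hF : ∀ x, Continuous fun y : E4 => φ.normed volume y * g (x - y) := fun x =>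
    hρc.mul (hg.continuous.comp (continuous_const.sub continuous_id))
  have hmoll : moll φ g = fun x => ∫ y, φ.normed volume y * g (x - y) := funext (moll_apply g)
  rw [hmoll]
  have key := hasFDerivAt_integral_of_dominated_of_fderiv_le (μ := volume) (s := ball x₀ 1)
    (F := fun x y => φ.normed volume y * g (x - y)) (F' := fun x y => φ.normed volume y • fderiv ℝ g (x - y))
    (x₀ := x₀) (bound := fun y => |φ.normed volume y| * M) (ball_mem_nhds x₀ one_pos)
    (Eventually.of_forall fun x => (hF x).aestronglyMeasurable)
    ((hF x₀).integrable_of_hasCompactSupport φ.hasCompactSupport_normed.mul_right)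
    ((hρc.smul ((hg.continuous_fderiv one_ne_zero).comp (continuous_const.sub continuous_id))).aestronglyMeasurable)
    (Eventually.of_forall fun y x hx => ?_) (φ.integrable_normed.abs.mul_const M)
    (Eventually.of_forall fun y x _ => ?_)
  · refine ⟨?_, key⟩
    -- integrability of `F' x₀`: continuous with compact support
    exact (hρc.smul ((hg.continuous_fderiv one_ne_zero).comp (continuous_const.sub continuous_id))).integrable_of_hasCompactSupport
      φ.hasCompactSupport_normed.smul_right
  · -- the bound
    rw [norm_smul, Real.norm_eq_abs]
    by_cases hy : φ.normed volume y = 0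
    · simp [hy]
    · refine mul_le_mul_of_nonneg_left (hM _ ?_) (abs_nonneg _)
      have hy' : y ∈ ball (0 : E4) φ.rOut := by
        have : y ∈ Function.support (φ.normed volume) := hy
        rwa [φ.support_normed_eq] at this
      rw [mem_closedBall, dist_eq_norm]
      calc ‖x - y - x₀‖ = ‖(x - x₀) - y‖ := by abel_nf
        _ ≤ ‖x - x₀‖ + ‖y‖ := norm_sub_le _ _
        _ ≤ 1 + φ.rOut := add_le_add (mem_ball_iff_norm.1 hx).le (mem_ball_zero_iff.1 hy').le
  · -- the pointwise derivative
    have h1 : HasFDerivAt (fun x : E4 => g (x - y)) (fderiv ℝ g (x - y)) x := by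
      have := ((hg.differentiable one_ne_zero) (x - y)).hasFDerivAt
      exact (hasFDerivAt_comp_sub y).mpr this |>.congr_fderiv rfl
    exact h1.const_mul (φ.normed volume y)

/-- **`∂_v(ρ ⋆ g) = ρ ⋆ ∂_vg`** for `g ∈ C¹`. [cite: Federbush1986PhaseCellI, Estimate 0.2 (0.3) p. 320] -/
theorem fderiv_moll_apply {g : E4 → ℝ} (hg : ContDiff ℝ 1 g) (x v : E4) :
    fderiv ℝ (moll φ g) x v = moll φ (fun z => fderiv ℝ g z v) x := by
  obtain ⟨hint, hd⟩ := hasFDerivAt_moll (φ := φ) hg x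
  rw [hd.fderiv, ContinuousLinearMap.integral_apply hint v, moll_apply]
  rfl

/-! ## §3 Vector potentials: mollification commutes with the field strength and kills pure gauges -/

/-- Componentwise mollification of a vector potential. [cite: Federbush1986PhaseCellI, §2 p. 325, §0 p. 319–320] -/
def mollV (φ : ContDiffBump (0 : E4)) (ψ : E4 → Fin 4 → ℝ) : E4 → Fin 4 → ℝ := fun x ν => moll φ (fun y => ψ y ν) x

/-- `ρ ⋆ ψ` is smooth for continuous `ψ`. [cite: Federbush1986PhaseCellI, §0 p. 319–320] -/
theorem contDiff_mollV {ψ : E4 → Fin 4 → ℝ} (hψ : Continuous ψ) {n : ℕ∞} : ContDiff ℝ n (mollV φ ψ) :=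
  contDiff_pi.2 fun ν => contDiff_moll ((continuous_apply ν).comp hψ)

/-- **`∂_μ(ρ ⋆ ψ)_ν = ρ ⋆ ∂_μψ_ν`** for `ψ ∈ C¹`. [cite: Federbush1986PhaseCellI, Estimate 0.2 (0.3) p. 320] -/
theorem pd_mollV {ψ : E4 → Fin 4 → ℝ} (hψ : ContDiff ℝ 1 ψ) (μ ν : Fin 4) (x : E4) :
    pd (mollV φ ψ) μ ν x = moll φ (pd ψ μ ν) x := by
  unfold pd mollV
  exact fderiv_moll_apply (contDiff_pi.1 hψ ν) x (unitVec μ)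

/-- **`F_{μν}(ρ ⋆ ψ) = ρ ⋆ F_{μν}(ψ)`** for `ψ ∈ C¹`. [cite: Federbush1986PhaseCellI, §0 p. 319–320] -/
theorem fieldStrength_mollV {ψ : E4 → Fin 4 → ℝ} (hψ : ContDiff ℝ 1 ψ) (μ ν : Fin 4) (x : E4) :
    fieldStrength (mollV φ ψ) μ ν x = moll φ (fieldStrength ψ μ ν) x := by
  have hc : ∀ μ ν, Continuous (pd ψ μ ν) := fun μ ν =>
    ((contDiff_pi.1 hψ ν).continuous_fderiv one_ne_zero).clm_apply continuous_const
  rw [fieldStrength, pd_mollV hψ, pd_mollV hψ, ← moll_sub (hc μ ν) (hc ν μ)]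
  rfl

/-- **Mollification maps pure gauges to pure gauges**: `ρ ⋆ dΛ = d(ρ ⋆ Λ)` for `Λ ∈ C¹`. [cite: Federbush1986PhaseCellI, (3.2) p. 327] -/
theorem mollV_pureGauge {Λ : E4 → ℝ} (hΛ : ContDiff ℝ 1 Λ) : mollV φ (pureGauge Λ) = pureGauge (moll φ Λ) := by
  funext x ν
  simp only [mollV, pureGauge]
  exact (fderiv_moll_apply hΛ x (unitVec ν)).symm

/-- **`F(dΘ) = 0` for `Θ ∈ C²`** (symmetry of second derivatives). [cite: Federbush1986PhaseCellI, §0 p. 319 («gauge invariant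
coupling»), (3.2) p. 327] -/
theorem fieldStrength_pureGauge {Θ : E4 → ℝ} (hΘ : ContDiff ℝ 2 Θ) (μ ν : Fin 4) (x : E4) :
    fieldStrength (pureGauge Θ) μ ν x = 0 := by
  have hd : DifferentiableAt ℝ (fderiv ℝ Θ) x :=
    ((hΘ.fderiv_right (m := 1) le_rfl).differentiable one_ne_zero) x
  have hpd : ∀ μ ν : Fin 4, pd (pureGauge Θ) μ ν x = fderiv ℝ (fderiv ℝ Θ) x (unitVec μ) (unitVec ν) := by
    intro μ ν
    unfold pd pureGauge
    rw [fderiv_clm_apply hd (differentiableAt_const _), fderiv_fun_const]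
    simp
  have hsymm : IsSymmSndFDerivAt ℝ Θ x := (hΘ.contDiffAt).isSymmSndFDerivAt (by simp)
  rw [fieldStrength, hpd, hpd, hsymm (unitVec μ) (unitVec ν), sub_self]

/-- **Mollification kills `C¹` pure gauges in the field strength**: `F(ρ ⋆ dΛ) = 0` for `Λ ∈ C¹`.
[cite: Federbush1986PhaseCellI, (3.2) p. 327] -/
theorem fieldStrength_mollV_pureGauge {Λ : E4 → ℝ} (hΛ : ContDiff ℝ 1 Λ) (μ ν : Fin 4) (x : E4) :
    fieldStrength (mollV φ (pureGauge Λ)) μ ν x = 0 := by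
  rw [mollV_pureGauge hΛ]
  exact fieldStrength_pureGauge (contDiff_moll (n := 2) hΛ.continuous) μ ν x

/-- **Uniform approximation of a continuous vector potential on compact sets.** [cite: Federbush1986PhaseCellI, §2 p. 325] -/
theorem mollV_uniform {ψ : E4 → Fin 4 → ℝ} (hψ : Continuous ψ) {K : Set E4} (hK : IsCompact K) {ε : ℝ} (hε : 0 < ε) :
    ∃ δ > 0, ∀ φ : ContDiffBump (0 : E4), φ.rOut ≤ δ → ∀ x ∈ K, ∀ ν, |mollV φ ψ x ν - ψ x ν| ≤ ε := by
  have h := fun ν : Fin 4 => moll_uniform ((continuous_apply ν).comp hψ) hK hε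
  choose δ hδ hν using h
  refine ⟨Finset.univ.inf' Finset.univ_nonempty δ, (Finset.lt_inf'_iff _).2 fun ν _ => hδ ν, fun φ hφ x hx ν => ?_⟩
  exact hν ν φ (hφ.trans (Finset.inf'_le _ (Finset.mem_univ ν))) x hx

end Mollify

end

end Literature.MathematicalPhysics.QuantumFieldTheory.Federbush1986
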